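import Summits.QuantumFields.GaugeBoot.DiagonalRPTorusHexAnnulusValueOdd
import Summits.QuantumFields.GaugeBoot.DiagonalRPTorusNegativeThreeUniform
import Summits.QuantumFields.GaugeBoot.DiagonalRPTorusNegativeUnitary
import HarnessLib

/-!
# Closed-half diagonal RP fails on ODD three-tori with a coupling window UNIFORM in `L` (gauge-boot, L3 `d = 3` uniform window, odd leg, assembly)

HONEST FRAMING (cell `pub-gaugeboot`, page 1 of every file): the venture produces certified bounds
on lattice expectations at stated coupling, gauge group, dimension and torus size; NOT a mass gap,
NOT a continuum limit, NOT a string tension; NOT Yang–Mills-summit-bearing (barriers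
`FixedCouplingUltralocality`, `PerturbativeInvisibility`). A structural NEGATIVE result about a
reflection-positivity HYPOTHESIS on discrete tori (the closed-half diagonal RP of
`DiagonalRPTorusNegative`, `L` odd); it certifies no bound of the venture.

## Content (torus `(ℤ/L)^3`, mirror `y₀ = y₁`, `L` odd, compact metrisable `G`, continuous `ρ`)

The odd twin of `DiagonalRPTorusInnerHalfNegativeThreeUniform`: the near pair of bent hexagons sits
across the cut between the layers `c` and `c + 1` (`L = 2c+1`), the joining annulus has SIX faces,
the near-pair jet is `τ₆ = c₁^7 N` (`DiagonalRPTorusHexAnnulusValueOdd`, kernel-checked scripts),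
the forest-split classification is the kernel-checked `DiagonalRPTorusHexCertOdd`.

* `hexObs_configDiagSwap_odd`, `dependsOn_hexFodd`, `isGaugeInvariant_hexFodd`, `disjoint_Et_odd`,
  `isDiagonalHalfObservable_hexObs_sub` — the witness on odd tori;
* ★★★ **`not_diagonalReflectionPositive_odd_three_uniform_of_moments`** — centre twist + (R1),
  `c₁ > 0`, `N ≥ 1` ⇒ ONE `β₀ > 0` with `¬ DiagonalReflectionPositive ρ β 0 1` for EVERY odd
  `L ≥ 31` and every `0 < β ≤ β₀`; `_specialUnitary`, `_unitary`;
* ★★★ **`not_diagonalReflectionPositive_odd_three_allL_specialUnitary/_unitary/_suN/_uN`** — glued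
  with the fixed-L windows of `DiagonalRPTorusNegativeOddSUN` / `DiagonalRPTorusNegativeUnitary`
  (lean3 gen 3x): ONE `β₀(N)` for ALL odd `L ≥ 3`;
* ★★★ **`diagonalRP_fails_three_uniform_suN/_uN`** — both parities: one `β₀(N)` for all `L ≥ 3`
  on `(ℤ/L)^3` (closed half for odd `L`, inner half for even `L`) — the `d = 3` case of
  `DiagRPRest.diagonalRP_fails_suN` with the quantifiers exchanged.

No named fact; standard axioms.
-/

open MeasureTheory Finset Function Filter Asymptotics
open scoped Topology

namespace Summit.QuantumFields.GaugeBoot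

open Literature.MathematicalPhysics.QuantumFieldTheory
open Literature.MathematicalPhysics.QuantumFieldTheory.PlaquetteLowerBound (reTr)

noncomputable section

namespace DiagRPHex

open DiagRPTube DiagRPUnif

variable {N : ℕ} {G : Type*} [Group G] [TopologicalSpace G] [IsTopologicalGroup G] [CompactSpace G]
  [MeasurableSpace G] [BorelSpace G] [SecondCountableTopology G] (ρ : G →* Matrix (Fin N) (Fin N) ℂ)

/-! ## The witness on odd tori -/

section Witness

variable {L : ℕ}

omit [TopologicalSpace G] [IsTopologicalGroup G] [CompactSpace G] [MeasurableSpace G] [BorelSpace G]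
  [SecondCountableTopology G] in
/-- ★ With `y₀ = θ(y + e₀)`: `hexObs y₀ ∘ Θ = hexFodd ρ y`. -/
theorem hexObs_configDiagSwap_odd (y : Site 3 L) (U : GaugeConfig 3 L G) :
    hexObs ρ (siteDiagSwap (0 : Fin 3) 1 (site y (1, 0, 0))) (configDiagSwap (0 : Fin 3) 1 U) = hexFodd ρ y U := by
  rw [hexObs, wordHolonomy_configDiagSwap, siteDiagSwap_siteDiagSwap, map_swapAxes_hexW]; rfl

omit [TopologicalSpace G] [IsTopologicalGroup G] [CompactSpace G] [MeasurableSpace G] [BorelSpace G]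
  [SecondCountableTopology G] in
/-- `hexFodd` reads `Et y LE₁odd`. -/
theorem dependsOn_hexFodd (y : Site 3 L) : DependsOn (hexFodd (G := G) ρ y) (Et y LE₁odd : Set (Edge 3 L)) := by
  refine fun U V hUV => dependsOn_reTr_wordHolonomy (G := G) ρ (site y (1, 0, 0)) thexW fun e he => hUV e ?_
  rw [Set.mem_setOf_eq, edgesRead_site] at he
  rw [mem_coe, Et, List.mem_toFinset]
  obtain ⟨ℓ, hℓ, rfl⟩ := List.mem_map.1 he
  exact List.mem_map.2 ⟨ℓ, ledges_thexW_odd_perm.subset hℓ, rfl⟩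

omit [TopologicalSpace G] [IsTopologicalGroup G] [CompactSpace G] [MeasurableSpace G] [BorelSpace G]
  [SecondCountableTopology G] in
/-- `hexFodd` is gauge invariant. -/
theorem isGaugeInvariant_hexFodd (y : Site 3 L) : IsGaugeInvariant (hexFodd (G := G) ρ y) :=
  isGaugeInvariant_reTr_wordHolonomy ρ (by rw [endpoint_site, lendpoint_thexW_odd])

/-- The two supports are disjoint on odd tori (`L > 8`). -/
theorem disjoint_Et_odd (hL : 8 < L) (y : Site 3 L) : Disjoint (Et y LE₁odd) (Et y LE₂) := by
  rw [Finset.disjoint_left]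
  intro e h1 h2
  obtain ⟨ℓ₁, hℓ₁, rfl⟩ := mem_Et.1 h1
  obtain ⟨ℓ₂, hℓ₂, he⟩ := mem_Et.1 h2
  have := edge_injOn y (B := 4) (by omega) (inBox_LE₂ ℓ₂ hℓ₂) (inBox_LE₁odd ℓ₁ hℓ₁) he
  subst this
  have hdis : ∀ ℓ ∈ LE₂, ℓ ∉ LE₁odd := by decide
  exact hdis ℓ₂ hℓ₂ hℓ₁

variable {c : ℕ}

/-- The layer of the mirrored base on an odd torus: `δ(θ(y + e₀)) = c` when `δ(y) = c`, `L = 2c+1`. -/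
theorem lay_y₀_odd (hL : L = 2 * c + 1) {y : Site 3 L} (hy : lay (0 : Fin 3) 1 y = ((c : ℕ) : ZMod L)) :
    lay (0 : Fin 3) 1 (siteDiagSwap (0 : Fin 3) 1 (site y (1, 0, 0))) = ((c : ℕ) : ZMod L) := by
  rw [lay_siteDiagSwap, lay_site, hy]
  have hL0 : ((2 * c + 1 : ℕ) : ZMod L) = 0 := by rw [← hL]; exact ZMod.natCast_self L
  simp only [loff]
  push_cast at hL0 ⊢
  linear_combination -hL0

/-- `cyc c = c` in `ℤ/(2c+1)`. -/
theorem cyc_cast_c_odd (hL : L = 2 * c + 1) : cyc (((c : ℕ) : ZMod L)) = c := by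
  unfold cyc
  rw [ZMod.valMinAbs_natCast_of_le_half (by omega)]
  simp

omit [TopologicalSpace G] [IsTopologicalGroup G] [CompactSpace G] [MeasurableSpace G] [BorelSpace G]
  [SecondCountableTopology G] in
/-- ★ **The witness difference is a closed-half observable** when both bases sit on the layer
`c` (`L = 2c + 1`, `c ≥ 1`). -/
theorem isDiagonalHalfObservable_hexObs_sub (hc : 1 ≤ c) (hLc : L = 2 * c + 1) {y₀ y : Site 3 L}
    (hy₀ : lay (0 : Fin 3) 1 y₀ = ((c : ℕ) : ZMod L)) (hy : lay (0 : Fin 3) 1 y = ((c : ℕ) : ZMod L)) :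
    IsDiagonalHalfObservable (0 : Fin 3) 1 fun U : GaugeConfig 3 L G => hexObs ρ y₀ U - hexObs ρ y U := by
  intro U V hUV
  have hL2 : L / 2 = c := by omega
  have hval : ∀ {y' : Site 3 L}, lay (0 : Fin 3) 1 y' = ((c : ℕ) : ZMod L) →
      ∀ e ∈ hexLinks y', U e = V e := by
    intro y' hy' e he
    obtain ⟨h1, h2⟩ := lay_hexLinks y' e he
    have hv : ∀ z : ZMod L, (z = lay 0 1 y' ∨ z = lay 0 1 y' - 1) → z.val ≤ L / 2 := by
      rintro z (rfl | rfl)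
      · rw [hy', hL2, val_cast (by omega)]
      · rw [hy', hL2, show ((c : ℕ) : ZMod L) - 1 = ((c - 1 : ℕ) : ZMod L) by
          rw [Nat.cast_sub hc, Nat.cast_one], val_cast (by omega)]
        omega
    exact hUV e (hv _ h1) (hv _ h2)
  show hexObs ρ y₀ U - hexObs ρ y U = hexObs ρ y₀ V - hexObs ρ y V
  rw [dependsOn_hexObs ρ y₀ (hval hy₀), dependsOn_hexObs ρ y (hval hy)]

end Witness

/-! ## The uniform window on odd tori -/

/-- ★★★ **CLOSED-HALF DIAGONAL RP FAILS ON ODD `(ℤ/L)^3` WITH AN `L`-INDEPENDENT WINDOW**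
(moment form): under the centre twist and (R1) with `c₁ > 0` (`N ≥ 1`), one `β₀ > 0` serves every
odd `L ≥ 31`. -/
theorem not_diagonalReflectionPositive_odd_three_uniform_of_moments (hρ : Continuous ρ) (hN : 1 ≤ N)
    {z₀ : G} {ω : ℂ} (hz₀ : ρ z₀ = ω • (1 : Matrix (Fin N) (Fin N) ℂ)) (hω : ω ≠ 1) {c₁ : ℝ}
    (hc₁ : 0 < c₁)
    (hR1 : ∀ x y : G, ∫ g, reTr ρ (x * g⁻¹) * reTr ρ (g * y) ∂haarProbability G = c₁ * reTr ρ (x * y)) :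
    ∃ β₀ : ℝ, 0 < β₀ ∧ ∀ (L : ℕ) [NeZero L], Odd L → 31 ≤ L → ∀ β : ℝ, 0 < β → β ≤ β₀ →
      ¬ DiagonalReflectionPositive (d := 3) (L := L) ρ β 0 1 := by
  -- the L-free constants
  set β₁ : ℝ := betaOne 3 ρ with hβ₁
  have hβ₁0 : 0 < β₁ := betaOne_pos 3 (ρ := ρ)
  set r : ℝ := β₁ / 2 with hr
  have hr0 : 0 < r := by positivity
  have hrR : r < β₁ := by rw [hr]; linarith
  set τ : ℝ := c₁ ^ 7 * N with hτ
  have hN0 : (0 : ℝ) < N := by exact_mod_cast hN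
  have hτ0 : 0 < τ := by positivity
  obtain ⟨K, hK0, hKdef⟩ : ∃ K : ℝ, 0 ≤ K ∧
      K = 2 * (N : ℝ) * N * (2 * Real.exp (1 / 2)) ^ ((6 + 6) * (2 ^ 3 * (3 * 3))) :=
    ⟨_, mul_nonneg (by positivity) (pow_nonneg (by positivity) _), rfl⟩
  set X : ℝ := τ * r ^ (6 + 1) / (2 * K + (K + |τ| * β₁ ^ 6) + 1) with hX
  have hX0 : 0 < X := by
    rw [hX]
    refine div_pos (mul_pos hτ0 (pow_pos hr0 _)) ?_
    have := mul_nonneg (abs_nonneg τ) (pow_nonneg hβ₁0.le 6)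
    linarith
  refine ⟨min r (X / 2), lt_min hr0 (half_pos hX0), ?_⟩
  intro L _ hLodd h31 β hβ hβ0
  obtain ⟨c, hcc⟩ := hLodd
  have hL : L = 2 * c + 1 := by omega
  have hc15 : 15 ≤ c := by omega
  have hL2 : L / 2 + 1 = c + 1 := by omega
  have hβr : β ≤ r := hβ0.trans (min_le_left _ _)
  have hβX : β < X := lt_of_le_of_lt (hβ0.trans (min_le_right _ _)) (by linarith)
  -- base points
  set y : Site 3 L := fun k => if k = 0 then (((c : ℕ) : ZMod L)) else 0 with hydef
  have hy : lay (0 : Fin 3) 1 y = ((c : ℕ) : ZMod L) := by simp [lay, hydef]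
  set y₀ : Site 3 L := siteDiagSwap (0 : Fin 3) 1 (site y (1, 0, 0)) with hy₀def
  have hy₀ : lay (0 : Fin 3) 1 y₀ = ((c : ℕ) : ZMod L) := lay_y₀_odd hL hy
  set a : Site 3 L := y - y₀ with hadef
  have ha : lay (0 : Fin 3) 1 a = 0 := by
    have : lay (0 : Fin 3) 1 a = lay 0 1 y - lay 0 1 y₀ := by simp [lay, hadef]; ring
    rw [this, hy, hy₀, sub_self]
  -- the witness and its properties
  set O : GaugeConfig 3 L G → ℝ := hexObs ρ y₀ with hO
  have hOm : Measurable O := (continuous_reTr_wordHolonomy ρ hρ _ _).measurable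
  have hOb : ∀ U, |O U| ≤ (N : ℝ) := fun U => abs_reTr_wordHolonomy_le ρ hρ _ _ U
  have hOE : DependsOn O (hexLinks y₀ : Set (Edge 3 L)) := dependsOn_hexObs ρ y₀
  have hE : ∀ e ∈ hexLinks y₀, tsd y₀ e.1 ≤ 1 := tsd_hexLinks_le y₀
  have hF : (fun U => O (configDiagSwap (0 : Fin 3) 1 U)) = hexFodd ρ y := by
    funext U; exact hexObs_configDiagSwap_odd ρ y U
  have hG : (fun U : GaugeConfig 3 L G => O (U.siteTranslate a)) = hexG ρ y := by
    funext U; exact hexObs_siteTranslate ρ y y₀ U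
  -- the jet of the near pair (J1 + J2, odd leg)
  have hL8 : 8 < L := by omega
  have hfm : Measurable (hexFodd (G := G) ρ y) := (continuous_reTr_wordHolonomy ρ hρ _ _).measurable
  have hgm : Measurable (hexG (G := G) ρ y) := (continuous_reTr_wordHolonomy ρ hρ _ _).measurable
  have hfb : ∀ U, |hexFodd (G := G) ρ y U| ≤ (N : ℝ) := fun U => abs_reTr_wordHolonomy_le ρ hρ _ _ U
  have hgb : ∀ U, |hexG (G := G) ρ y U| ≤ (N : ℝ) := fun U => abs_reTr_wordHolonomy_le ρ hρ _ _ U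
  have hsmall := sum_replicaTerm_small_eq_hexTubeOdd ρ hc15 hL hy hρ hfm hgm hfb hgb
    (isGaugeInvariant_hexFodd ρ y) (dependsOn_hexFodd ρ y) (dependsOn_hexG ρ y)
  have hjet : (fun z => restTruncC ρ (restPlaqs (0 : Fin 3) 1 (c + 1))
      (fun U => O (configDiagSwap (0 : Fin 3) 1 U)) (fun U : GaugeConfig 3 L G => O (U.siteTranslate a)) z -
        (τ : ℂ) * z ^ 6) =O[𝓝 (0 : ℂ)] fun z => z ^ (6 + 1) := by
    rw [hF, hG]
    refine restTruncC_jet_of_smallClusters ρ hρ (restPlaqs (0 : Fin 3) 1 (c + 1)) hfm hgm hfb hgb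
      (dependsOn_hexFodd ρ y) (dependsOn_hexG ρ y) (disjoint_Et_odd hL8 y) ?_
    have hj := replicaTerm_hexTubeOdd_jet ρ y hL8 hρ hz₀ hω hR1
    have h2 := hj.const_mul_left (1 / 2 : ℂ)
    refine h2.congr' (Eventually.of_forall fun z => ?_) EventuallyEq.rfl
    simp only [hsmall z, hτ]
    push_cast
    ring
  have hfar : 2 * 1 + 6 + 3 ≤ cyc (lay (0 : Fin 3) 1 y₀) := by
    rw [hy₀, cyc_cast_c_odd hL]; omega
  have hcard : (hexLinks y₀).card = 6 := card_hexLinks hL8 y₀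
  have hβc : β < τ * r ^ (6 + 1) /
      (2 * (2 * (N : ℝ) * N * (2 * Real.exp (1 / 2)) ^ (((hexLinks y₀).card + (hexLinks y₀).card) *
        (2 ^ 3 * (3 * 3)))) +
        (2 * (N : ℝ) * N * (2 * Real.exp (1 / 2)) ^ (((hexLinks y₀).card + (hexLinks y₀).card) *
          (2 ^ 3 * (3 * 3))) + |τ| * betaOne 3 ρ ^ 6) + 1) := by
    rw [hcard, ← hKdef]; exact hβX
  have hneg := trickForm_sub_translate_neg_of_jet β (0 : Fin 3) 1 (c + 1) hρ hOm hOb hOE hE ha hjet hfar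
    hr0 hrR hβ hβr hβc
  -- the refutation schema (odd `L`, closed half)
  have hA : Continuous fun U : GaugeConfig 3 L G => O U - O (U.siteTranslate a) :=
    (continuous_reTr_wordHolonomy ρ hρ _ _).sub
      ((continuous_reTr_wordHolonomy ρ hρ _ _).comp (continuous_pi fun _ => continuous_apply _))
  have hAI : IsDiagonalHalfObservable (0 : Fin 3) 1 fun U : GaugeConfig 3 L G => O U - O (U.siteTranslate a) := by
    have : (fun U : GaugeConfig 3 L G => O U - O (U.siteTranslate a)) =
        fun U => hexObs ρ y₀ U - hexObs ρ y U := by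
      funext U; rw [hO, hexObs_siteTranslate ρ y y₀ U, hexG_eq_hexObs]
    rw [this]
    exact isDiagonalHalfObservable_hexObs_sub ρ (by omega) hL hy₀ hy
  rw [← hL2] at hneg
  exact not_diagonalReflectionPositive_of_trickForm_neg ρ hρ ⟨c, hcc⟩ hA hAI hneg

/-- ★★ **Uniform window for `G ≅ SU(N)`** (`N ≥ 2`) on odd `(ℤ/L)^3`, `L ≥ 31`. -/
theorem not_diagonalReflectionPositive_odd_three_uniform_specialUnitary (hρ : IsSpecialUnitaryModel ρ)
    (hN : 2 ≤ N) :
    ∃ β₀ : ℝ, 0 < β₀ ∧ ∀ (L : ℕ) [NeZero L], Odd L → 31 ≤ L → ∀ β : ℝ, 0 < β → β ≤ β₀ →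
      ¬ DiagonalReflectionPositive (d := 3) (L := L) ρ β 0 1 := by
  obtain ⟨z₀, ω, hω, hz₀⟩ := DiagRPSUN.exists_smul_one ρ hρ hN
  obtain ⟨c₁, hc₁, hR1⟩ := DiagRPSUN.exists_re_conv_const ρ hρ hN
  exact not_diagonalReflectionPositive_odd_three_uniform_of_moments ρ hρ.1 (by omega) hz₀ hω hc₁ hR1

/-- ★★ **Uniform window for `G ≅ U(N)`** (`N ≥ 1`) on odd `(ℤ/L)^3`, `L ≥ 31`. -/
theorem not_diagonalReflectionPositive_odd_three_uniform_unitary (hρ : IsUnitaryModel ρ) (hN : 1 ≤ N) :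
    ∃ β₀ : ℝ, 0 < β₀ ∧ ∀ (L : ℕ) [NeZero L], Odd L → 31 ≤ L → ∀ β : ℝ, 0 < β → β ≤ β₀ →
      ¬ DiagonalReflectionPositive (d := 3) (L := L) ρ β 0 1 := by
  obtain ⟨z₀, ω, hω, hz₀⟩ := DiagRPSUN.exists_smul_one_unitary ρ hρ
  have hNpos : (0 : ℝ) < N := by exact_mod_cast hN
  exact not_diagonalReflectionPositive_odd_three_uniform_of_moments ρ hρ.1 hN hz₀ hω
    (c₁ := (2 * N : ℝ)⁻¹) (by positivity) (DiagRPSUN.integral_re_trace_mul_inv_mul_unitary ρ hρ)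

/-! ## All odd tori, and both parities -/

/-- Gluing a uniform window above a threshold with pointwise windows below it (odd tori). -/
theorem exists_uniform_window_of_threshold_odd {P : ∀ (L : ℕ) [NeZero L], ℝ → Prop} {L₀ : ℕ}
    (hbig : ∃ β₀ : ℝ, 0 < β₀ ∧ ∀ (L : ℕ) [NeZero L], Odd L → L₀ ≤ L → ∀ β : ℝ, 0 < β → β ≤ β₀ → P L β)
    (hsmall : ∀ (L : ℕ) [NeZero L], Odd L → 3 ≤ L → ∃ β₀ : ℝ, 0 < β₀ ∧ ∀ β : ℝ, 0 < β → β ≤ β₀ → P L β) :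
    ∃ β₀ : ℝ, 0 < β₀ ∧ ∀ (L : ℕ) [NeZero L], Odd L → 3 ≤ L → ∀ β : ℝ, 0 < β → β ≤ β₀ → P L β := by
  classical
  obtain ⟨βu, hβu, hu⟩ := hbig
  have hs : ∀ L : ℕ, ∃ b : ℝ, 0 < b ∧
      ∀ [NeZero L], Odd L → 3 ≤ L → ∀ β : ℝ, 0 < β → β ≤ b → P L β := by
    intro L
    by_cases h : Odd L ∧ 3 ≤ L
    · haveI : NeZero L := ⟨by omega⟩
      obtain ⟨b, hb, hbb⟩ := hsmall L h.1 h.2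
      exact ⟨b, hb, fun _ _ β hβ hβb => hbb β hβ hβb⟩
    · exact ⟨1, one_pos, fun hE h3 => absurd ⟨hE, h3⟩ h⟩
  choose b hb hbb using hs
  have hne : (Finset.range (L₀ + 1)).Nonempty := ⟨0, by simp⟩
  set βs : ℝ := (Finset.range (L₀ + 1)).inf' hne b with hβs
  have hβs0 : 0 < βs := by
    rw [hβs, Finset.lt_inf'_iff]
    exact fun L _ => hb L
  refine ⟨min βu βs, lt_min hβu hβs0, fun L _ hO h3 β hβ hβ0 => ?_⟩
  rcases le_or_gt L₀ L with hL | hL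
  · exact hu L hO hL β hβ (hβ0.trans (min_le_left _ _))
  · have hmem : L ∈ Finset.range (L₀ + 1) := Finset.mem_range.2 (by omega)
    have hle : βs ≤ b L := Finset.inf'_le _ hmem
    exact hbb L hO h3 β hβ ((hβ0.trans (min_le_right _ _)).trans hle)

/-- ★★★ **`G ≅ SU(N)`, `N ≥ 2`: ONE window for ALL odd three-tori `L ≥ 3`.** -/
theorem not_diagonalReflectionPositive_odd_three_allL_specialUnitary (hρ : IsSpecialUnitaryModel ρ)
    (hN : 2 ≤ N) :
    ∃ β₀ : ℝ, 0 < β₀ ∧ ∀ (L : ℕ) [NeZero L], Odd L → 3 ≤ L → ∀ β : ℝ, 0 < β → β ≤ β₀ →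
      ¬ DiagonalReflectionPositive (d := 3) (L := L) ρ β 0 1 :=
  exists_uniform_window_of_threshold_odd
    (P := fun L _ β => ¬ DiagonalReflectionPositive (d := 3) (L := L) ρ β 0 1)
    (not_diagonalReflectionPositive_odd_three_uniform_specialUnitary ρ hρ hN)
    (fun _ _ hO h3 => DiagRPSUN.not_diagonalReflectionPositive_odd_specialUnitary ρ hρ hN hO h3)

/-- ★★★ **`G ≅ U(N)`, `N ≥ 1`: ONE window for ALL odd three-tori `L ≥ 3`.** -/
theorem not_diagonalReflectionPositive_odd_three_allL_unitary (hρ : IsUnitaryModel ρ) (hN : 1 ≤ N) :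
    ∃ β₀ : ℝ, 0 < β₀ ∧ ∀ (L : ℕ) [NeZero L], Odd L → 3 ≤ L → ∀ β : ℝ, 0 < β → β ≤ β₀ →
      ¬ DiagonalReflectionPositive (d := 3) (L := L) ρ β 0 1 :=
  exists_uniform_window_of_threshold_odd
    (P := fun L _ β => ¬ DiagonalReflectionPositive (d := 3) (L := L) ρ β 0 1)
    (not_diagonalReflectionPositive_odd_three_uniform_unitary ρ hρ hN)
    (fun _ _ hO h3 => DiagRPSUN.not_diagonalReflectionPositive_odd_unitary ρ hρ hN hO h3)

section Groups

open Literature.MathematicalPhysics.QuantumLattice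

/-- ★★★ **Diagonal RP fails on EVERY three-torus for `SU(N)` with ONE window.** For `N ≥ 2` there is
`β₀(N) > 0` such that for every `L ≥ 3` and all `0 < β ≤ β₀`, the `SU(N)` Wilson theory on `(ℤ/L)^3`
violates diagonal reflection positivity across `x₀ = x₁`: the closed-half form when `L` is odd, the
inner-half form when `L` is even. -/
theorem diagonalRP_fails_three_uniform_suN {N : ℕ} (hN : 2 ≤ N) :
    ∃ β₀ : ℝ, 0 < β₀ ∧ ∀ (L : ℕ) [NeZero L], 3 ≤ L → ∀ β : ℝ, 0 < β → β ≤ β₀ →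
      (Odd L → ¬ DiagonalReflectionPositive (d := 3) (L := L) (fundamentalRep (Fin N)) β 0 1) ∧
        (Even L → ¬ InnerDiagonalRP (d := 3) (L := L) (fundamentalRep (Fin N)) β 0 1) := by
  haveI : SecondCountableTopology (Matrix (Fin N) (Fin N) ℂ) :=
    inferInstanceAs (SecondCountableTopology (Fin N → Fin N → ℂ))
  haveI : SecondCountableTopology (Matrix.specialUnitaryGroup (Fin N) ℂ) :=
    Topology.IsEmbedding.subtypeVal.secondCountableTopology
  obtain ⟨βo, hβo, ho⟩ := not_diagonalReflectionPositive_odd_three_allL_specialUnitary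
    (fundamentalRep (Fin N)) (TorusAreaLaw.isSpecialUnitaryModel_fundamentalRep N) hN
  obtain ⟨βe, hβe, he⟩ := not_innerDiagonalRP_even_three_allL_suN hN
  refine ⟨min βo βe, lt_min hβo hβe, fun L _ h3 β hβ hβ0 => ⟨fun hO => ?_, fun hE => ?_⟩⟩
  · exact ho L hO h3 β hβ (hβ0.trans (min_le_left _ _))
  · have h4 : 4 ≤ L := by obtain ⟨c, hc⟩ := hE; omega
    exact he L hE h4 β hβ (hβ0.trans (min_le_right _ _))

/-- ★★★ **Diagonal RP fails on EVERY three-torus for `U(N)` (`N ≥ 1`) with ONE window.** -/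
theorem diagonalRP_fails_three_uniform_uN {N : ℕ} (hN : 1 ≤ N) :
    ∃ β₀ : ℝ, 0 < β₀ ∧ ∀ (L : ℕ) [NeZero L], 3 ≤ L → ∀ β : ℝ, 0 < β → β ≤ β₀ →
      (Odd L → ¬ DiagonalReflectionPositive (d := 3) (L := L) (unitaryFundamentalRep (Fin N) ℂ) β 0 1) ∧
        (Even L → ¬ InnerDiagonalRP (d := 3) (L := L) (unitaryFundamentalRep (Fin N) ℂ) β 0 1) := by
  haveI : SecondCountableTopology (Matrix.unitaryGroup (Fin N) ℂ) :=
    IsUnitaryModel.secondCountableTopology _ (isUnitaryModel_unitaryFundamentalRep N)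
  obtain ⟨βo, hβo, ho⟩ := not_diagonalReflectionPositive_odd_three_allL_unitary
    (unitaryFundamentalRep (Fin N) ℂ) (isUnitaryModel_unitaryFundamentalRep N) hN
  obtain ⟨βe, hβe, he⟩ := not_innerDiagonalRP_even_three_allL_uN hN
  refine ⟨min βo βe, lt_min hβo hβe, fun L _ h3 β hβ hβ0 => ⟨fun hO => ?_, fun hE => ?_⟩⟩
  · exact ho L hO h3 β hβ (hβ0.trans (min_le_left _ _))
  · have h4 : 4 ≤ L := by obtain ⟨c, hc⟩ := hE; omega
    exact he L hE h4 β hβ (hβ0.trans (min_le_right _ _))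

end Groups

end DiagRPHex

end

end Summit.QuantumFields.GaugeBoot
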